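import Literature.MathematicalPhysics.QuantumFieldTheory.King1986.CovarianceQstar
import Literature.MathematicalPhysics.QuantumFieldTheory.King1986.MinimizerBlockDecay
import Literature.MathematicalPhysics.QuantumFieldTheory.King1986.CovarianceRateTorus
import HarnessLib

/-!
# King 1986, p. 675: Proposition 3.7 for the TOP-SCALE row `C^ηQ^*_K` — uniform exponential decay of `(Δ^{(K)})⁻¹` on the
# unit torus (Combes–Thomas) and of `C^ηQ^*_K(x, b) = Σ_{b′} ℋ_K(x, b′)(Δ^{(K)})⁻¹(b′, b)` on Bałaban's volumes

**Citation header (reproduction of PUBLISHED and PROVED work; seat `pub-ymgap-dag-n18-b` (g2) of the cell `pub-ymgap`,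
Track-A node N18 = NE5 whose PRINTED MODEL of record is King's Prop. 3.8 ∕ 3.9; fifteenth file of the seat's chain — the
first half of the estimates announced as the sequel of `CovarianceQstar` ((4.44)–(4.45)): the decay of the top-scale row,
King p. 675 «We can extend Δ^ε(p)^{−1} to an analytic function … and therefore we may extract a decay factor exp[−δ₀|x − y|]
from (4.45)», obtained here WITHOUT the analytic continuation, from the structural identity `C^ηQ^*_K = ℋ_K·(Δ^{(K)})⁻¹`.)**
C. King, *The U(1) Higgs model. I. The continuum limit*, Commun. Math. Phys. **102** (1986) 649–677 [King1986], §4 p. 675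
(4.44)–(4.45) and the paragraph after (4.45); Theorem 3.3 p. 658; Prop. 3.7 p. 663; (4.33)–(4.34) p. 674 («Using the
general results of Chap. 5 of [Ba 4], C^{(k)}_Ω(s) has uniform exponential decay if … (i) … ≧ γ₀I, (ii) |…(x, y)| ≦
C exp[−δ₀|x − y|]»).  King's paper is TEMPLATE LITERATURE (printed and proved `A = 0` mechanism); nothing here is about
Bałaban's covariant objects.

**What this file PROVES (kernel).**
* §1 `gamM`, `kapM` (explicit constants) and **`effLaplacian_inv_decay`**: for `a > 0`, `m² > 0`, `L ≥ 2`, `k ≥ 1`, EVERY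
  unit torus `Π ℤ∕M′_μ`: `|(Δ^{(k)})⁻¹(b, b′)| ≤ (2∕γ_m)·e^{−κ_m·tdistT(b, b′)}`, `γ_m = (a_min⁻¹ + m⁻²)⁻¹` (the N-uniform
  coercivity `CovarianceQstar.effLaplacian_coercive`), `κ_m = rate(K_d, γ_m, C_U, κ_U)` — the finite Combes–Thomas lemma
  `QGQInverse.inverse_decay` fed with (i) = coercivity and (ii) = `CovarianceRateTorus.effLaplacian_entry_le_unif` through
  `B4Sect5Torus.weightedRowSum_le` ∕ `weightedColSum_le` ∕ `rate_mul_weightC_le`, exactly as `king_lemma45_torus` does for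
  `(Δ^{(k)} + aL⁻²Q*Q)⁻¹`; here the mass replaces the averaging term as the source of coercivity.
* §2 `effLaplacian_sub_apply_le_torus`: Lemma 4.3 in kernel form on EVERY unit torus (the tree's
  `effLaplacian_sub_apply_le` is typed on `Π ℤ∕(LM_μ)` only): `|Δ^{(k+n)}(z, w) − Δ^{(k)}(z, w)| ≤ θ_k·a`.
* §3 `exp_conv_le` (two-factor exponential convolution on a torus) and **`covQstar_kernel_decay_blocks`** — PROP. 3.7 FOR
  THE TOP-SCALE ROW on Bałaban's volumes: there are `δ, c > 0` (functions of `d, L, a, m²`) with `|C^ηQ^*_K(x, b)| ≤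
  c·exp(−δ·tdistT M (B(x)) b)` for every volume (`K ≥ 1`), every spelling `N = L^K`, every fine point `x` and unit site
  `b` — `covQstar_kernel_eq_sum` + `minimiser_kernel_decay_blocks` (Theorem 3.3 for `ℋ_K`) + §1 + lattice sums.

**NOT COVERED (sequel).**  The two-spacing rate of `C^ηQ^*_K` (Prop. 3.8 ∕ 3.9 for the top-scale row: `(ℋ′ − ℋ)·Δ′⁻¹ +
ℋ·(Δ′⁻¹ − Δ⁻¹)` with §2 and `CovarianceRate.sub_kernel_rate` ∕ `triple_decay_bound`); the assembled `G^η_{(K)}`; even `L`;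
`A ≠ 0`.  HONEST FRAMING: King's `A = 0` scalar MODEL — template literature on a finite torus; nothing about Bałaban's
covariant objects; nothing continuum ∕ mass-gap ∕ Clay; count-neutral for the cell's 27 nodes.
-/

noncomputable section

open Finset Real Matrix
open scoped BigOperators

namespace Literature.MathematicalPhysics.QuantumFieldTheory.King1986

open Literature.MathematicalPhysics.QuantumFieldTheory.Balaban1983to89 (Params)
open Literature.MathematicalPhysics.QuantumFieldTheory.Balaban1983to89.B5Prop11Plancherel
open Literature.MathematicalPhysics.QuantumFieldTheory.Balaban1983to89.QGQInverse (Coercive inverse_decay)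
open Literature.MathematicalPhysics.QuantumFieldTheory.Balaban1983to89.B4Sect5Torus
  (IsPseudoDist SumBound weightC rate rate_pos rate_le_quarter rate_mul_weightC_le weightedRowSum_le weightedColSum_le)

namespace Torus

variable {d : ℕ}

/-! ## §1 Uniform exponential decay of `(Δ^{(k)})⁻¹` on every unit torus -/

variable (d) in
/-- The N-uniform coercivity constant of `Δ^{(k)}`: `γ_m = (a_min⁻¹ + m⁻²)⁻¹`, `a_min = a(1 − L⁻²) ≤ a_k`.
[cite: King1986, (4.33) p.674, (4.5) p.670] -/
def gamM (a m2 : ℝ) (L : ℕ) : ℝ := ((aminL a L)⁻¹ + m2⁻¹)⁻¹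

variable (d) in
/-- The Combes–Thomas rate for `(Δ^{(k)})⁻¹`: `κ_m = rate(K_d, γ_m, C_U, κ_U)` of `B4Sect5Torus`.
[cite: King1986, (4.34) p.674] -/
def kapM (a m2 : ℝ) (L : ℕ) : ℝ :=
  rate (Balaban1983to89.B4Sect5Proof.latticeConst d) (gamM a m2 L) (CDelU d a (aminL a L)) (kapU d a (aminL a L))

/-- `γ_m > 0`. [cite: King1986, (4.33) p.674] -/
theorem gamM_pos {a m2 : ℝ} (ha : 0 < a) (hm : 0 < m2) {L : ℕ} (hL : 2 ≤ L) : 0 < gamM a m2 L := by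
  unfold gamM
  have := aminL_pos ha hL
  positivity

/-- `0 < κ_m ≤ κ_U∕4`. [cite: King1986, (4.34) p.674] -/
theorem kapM_pos_le {a m2 : ℝ} (ha : 0 < a) (hm : 0 < m2) {L : ℕ} (hL : 2 ≤ L) :
    0 < kapM d a m2 L ∧ kapM d a m2 L ≤ kapU d a (aminL a L) / 4 := by
  have hamin := aminL_pos ha hL
  obtain ⟨hκU0, _⟩ := kapU_pos_le (d := d) ha hamin
  exact ⟨rate_pos (latticeConst_profile_nonneg d) (gamM_pos ha hm hL) (CDelU_pos ha hamin).le hκU0,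
    rate_le_quarter _ _ _⟩

/-- `0 ≤ x ⬝ᵥ x` for real vectors. [folklore] -/
private theorem dotProduct_self_nonneg' {n : Type*} [Fintype n] (x : n → ℝ) : 0 ≤ x ⬝ᵥ x :=
  Finset.sum_nonneg fun i _ => mul_self_nonneg (x i)

/-- **UNIFORM EXPONENTIAL DECAY OF `(Δ^{(k)})⁻¹`** (King's «C^{(k)}_Ω(s) has uniform exponential decay if (i) … ≧ γ₀I,
(ii) |…(x, y)| ≦ C exp[−δ₀|x − y|]», here for the effective Laplacian ALONE, the mass supplying (i)): for `a > 0`,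
`m² > 0`, `L ≥ 2`, `k ≥ 1` and EVERY unit torus, `|(Δ^{(k)})⁻¹(b, b′)| ≤ (2∕γ_m)·e^{−κ_m·tdistT(b, b′)}` with `γ_m`, `κ_m`
depending on `a, m², L, d` only — (i) `CovarianceQstar.effLaplacian_coercive` (`≥ (a_k⁻¹ + m⁻²)⁻¹ ≥ γ_m`), (ii)
`effLaplacian_entry_le_unif`, the finite Combes–Thomas lemma `inverse_decay`. [cite: King1986, (4.33)–(4.34) p.674] -/
theorem effLaplacian_inv_decay {a m2 : ℝ} (ha : 0 < a) (hm : 0 < m2) {L k : ℕ} [NeZero L] (hL : 2 ≤ L) (hk : 1 ≤ k)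
    (M' : Fin d → ℕ) [∀ μ, NeZero (M' μ)] (b b' : Tor M') :
    |(effLaplacian (L ^ k) M' (aK a L k) (((L ^ k : ℕ) : ℝ) ^ 2) m2)⁻¹ b b'|
      ≤ (2 / gamM a m2 L) * Real.exp (-(kapM d a m2 L * tdistT M' b b')) := by
  set Δ := effLaplacian (L ^ k) M' (aK a L k) (((L ^ k : ℕ) : ℝ) ^ 2) m2 with hΔ
  set amin := aminL a L with hamin_def
  set γ := gamM a m2 L with hγ
  set κ' := kapM d a m2 L with hκ'
  set κU := kapU d a amin with hκU
  set CU := CDelU d a amin with hCU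
  set Kd := Balaban1983to89.B4Sect5Proof.latticeConst d with hKd
  set ρd := tdistT M' with hρd
  have hL1r : (1 : ℝ) < L := by exact_mod_cast hL
  have hN1 : 1 ≤ L ^ k := Nat.one_le_pow k L (by omega)
  have hamin : 0 < amin := aminL_pos ha hL
  obtain ⟨hak1, hak2⟩ := aminL_le_aK ha hL hk
  have haK : 0 < aK a L k := lt_of_lt_of_le hamin hak1
  have hγpos : 0 < γ := gamM_pos ha hm hL
  obtain ⟨hκU0, hκU1⟩ := kapU_pos_le (d := d) ha hamin
  have hCU0 : 0 < CU := CDelU_pos ha hamin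
  obtain ⟨hκ'0, hκ'U⟩ := kapM_pos_le (d := d) ha hm hL
  have hKd : ∀ t : ℝ, 0 < t → 0 ≤ Kd t := latticeConst_profile_nonneg d
  -- (i) coercivity with the uniform constant γ_m ≤ (a_k⁻¹ + m⁻²)⁻¹
  have hcoer0 : Coercive Δ (((aK a L k)⁻¹ + m2⁻¹)⁻¹) := effLaplacian_coercive (L ^ k) M' hN1 haK hm
  have hγle : γ ≤ ((aK a L k)⁻¹ + m2⁻¹)⁻¹ := by
    rw [hγ, gamM]
    have h1 : (aK a L k)⁻¹ ≤ (aminL a L)⁻¹ := inv_anti₀ hamin hak1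
    exact inv_anti₀ (by positivity) (by linarith)
  have hcoer : Coercive Δ γ := fun x =>
    (mul_le_mul_of_nonneg_right hγle (dotProduct_self_nonneg' x)).trans (hcoer0 x)
  -- (ii) pointwise decay
  have hD : ∀ z w, |Δ z w| ≤ CU * Real.exp (-(κU * ρd z w)) := fun z w =>
    effLaplacian_entry_le_unif ha hamin hak1 hak2 hm (L ^ k) M' z w
  -- weighted sums
  have hpd : IsPseudoDist ρd := tdistT_isPseudoDist M'
  have hSB : SumBound ρd Kd := tdistT_sumBound M'
  have hrow : ∀ i, ∑ j, |Δ i j| * (Real.exp (κ' * ρd i j) - 1) ≤ κ' * weightC Kd CU κU := fun i =>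
    weightedRowSum_le hpd.nonneg hSB Δ hCU0.le hκU0 hκ'0.le hκ'U hD i
  have hcol : ∀ j, ∑ i, |Δ i j| * (Real.exp (κ' * ρd i j) - 1) ≤ κ' * weightC Kd CU κU := fun j =>
    weightedColSum_le hpd hSB Δ hCU0.le hκU0 hκ'0.le hκ'U hD j
  have hρ : κ' * weightC Kd CU κU ≤ γ / 2 := rate_mul_weightC_le hKd hγpos hCU0.le hκU0
  have hργ : κ' * weightC Kd CU κU < γ := by linarith
  have h := inverse_decay Δ ρd hργ hκ'0.le hcoer hpd.symm hpd.zero hpd.triangle hrow hcol b b'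
  refine h.trans (mul_le_mul_of_nonneg_right ?_ (Real.exp_pos _).le)
  rw [div_eq_mul_inv, show (2 : ℝ) * γ⁻¹ = (γ / 2)⁻¹ by rw [inv_div]; ring]
  exact inv_anti₀ (by positivity) (by linarith)

/-! ## §2 Lemma 4.3 in kernel form on every unit torus -/

/-- **`|Δ^{(k+n)}(z, w) − Δ^{(k)}(z, w)| ≤ θ_k·a` on EVERY unit torus** (the tree's `effLaplacian_sub_apply_le`, re-typed
from `Π ℤ∕(LM_μ)` to an arbitrary `Π ℤ∕M′_μ`; same proof: the symbol rate `abs_DeltaEff_sub_le_thetaK` through the plane-wave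
form (4.35) and polarization). [cite: King1986, Lemma 4.3 (4.18) p.672, (4.35) p.674, (4.41) p.675] -/
theorem effLaplacian_sub_apply_le_torus {a m2 : ℝ} (ha : 0 < a) (hm : 0 < m2) {L k n : ℕ} [NeZero L] (hL : 2 ≤ L)
    (hk : 1 ≤ k) (hn : 1 ≤ n) (M' : Fin d → ℕ) [∀ μ, NeZero (M' μ)] (z w : Tor M') :
    |effLaplacian (L ^ n * L ^ k) M' (aK a L (k + n)) (((L ^ n * L ^ k : ℕ) : ℝ) ^ 2) m2 z w
        - effLaplacian (L ^ k) M' (aK a L k) (((L ^ k : ℕ) : ℝ) ^ 2) m2 z w|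
      ≤ thetaK a L k n * a := by
  have hL1 : (1 : ℝ) < L := by exact_mod_cast hL
  have hN₁ : 1 ≤ L ^ k := Nat.one_le_pow k L (by omega)
  have hN₀ : 1 ≤ L ^ n * L ^ k := Nat.one_le_iff_ne_zero.mpr (NeZero.ne _)
  have ha₁ : 0 < aK a L k := aK_pos ha hL1 hk
  have ha₀ : 0 < aK a L (k + n) := aK_pos ha hL1 (by omega)
  rw [abs_sub_comm]
  exact abs_sub_apply_le_of_symbols M' _ _
    (effLaplacian_symm (L ^ k) M' _ _ _) (effLaplacian_symm (L ^ n * L ^ k) M' _ _ _)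
    (fun q => DeltaEff (aK a L k) (L ^ k) m2 (sOf M' q))
    (fun q => DeltaEff (aK a L (k + n)) (L ^ n * L ^ k) m2 (sOf M' q))
    (effLaplacian_form_DeltaEff (L ^ k) M' hN₁ ha₁ hm)
    (effLaplacian_form_DeltaEff (L ^ n * L ^ k) M' hN₀ ha₀ hm)
    (fun q => abs_DeltaEff_sub_le_thetaK ha hL hk hn hm (fun μ => abs_sOf_le M' q μ)) z w

/-! ## §3 Proposition 3.7 for the top-scale row `C^ηQ^*_K` on Bałaban's volumes -/

/-- **Two-factor exponential convolution on a torus**: `Σ_z e^{−κ₁ρ(p,z)}e^{−κ₂ρ(z,q)} ≤ K(κ)·e^{−κρ(p,q)}` for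
`κ ≤ min(κ₁, κ₂)∕2`, `κ > 0` (`ρ` a pseudo-distance with lattice sums `SumBound ρ K`) — the lattice-sum step of King's
«(3.64) follows from (4.45)» for the composed kernel. [cite: King1986, Prop. 3.7 (3.64) p.663, p.675] -/
theorem exp_conv_le {n : Type*} [Fintype n] {ρ : n → n → ℝ} (hρ : IsPseudoDist ρ) {K : ℝ → ℝ}
    (hS : SumBound ρ K) {κ₁ κ₂ κ : ℝ} (hκ : 0 < κ) (h1 : 2 * κ ≤ κ₁) (h2 : 2 * κ ≤ κ₂) (p q : n) :
    ∑ z, Real.exp (-(κ₁ * ρ p z)) * Real.exp (-(κ₂ * ρ z q)) ≤ K κ * Real.exp (-(κ * ρ p q)) := by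
  have hpt : ∀ z, Real.exp (-(κ₁ * ρ p z)) * Real.exp (-(κ₂ * ρ z q))
      ≤ Real.exp (-(κ * ρ p q)) * Real.exp (-(κ * ρ z q)) := by
    intro z
    rw [← Real.exp_add, ← Real.exp_add]
    apply Real.exp_le_exp.mpr
    have t := hρ.triangle p z q
    have n1 := hρ.nonneg p z
    have n2 := hρ.nonneg z q
    nlinarith
  calc ∑ z, Real.exp (-(κ₁ * ρ p z)) * Real.exp (-(κ₂ * ρ z q))
      ≤ ∑ z, Real.exp (-(κ * ρ p q)) * Real.exp (-(κ * ρ z q)) := Finset.sum_le_sum fun z _ => hpt z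
    _ = Real.exp (-(κ * ρ p q)) * ∑ z, Real.exp (-(κ * ρ z q)) := by rw [Finset.mul_sum]
    _ ≤ Real.exp (-(κ * ρ p q)) * K κ := by
        refine mul_le_mul_of_nonneg_left ?_ (Real.exp_pos _).le
        have h := hS κ hκ q
        have hsym : ∑ z, Real.exp (-(κ * ρ z q)) = ∑ z, Real.exp (-(κ * ρ q z)) :=
          Finset.sum_congr rfl fun z _ => by rw [hρ.symm z q]
        rw [hsym]; exact h
    _ = K κ * Real.exp (-(κ * ρ p q)) := mul_comm _ _

/-- **PROPOSITION 3.7 FOR THE TOP-SCALE ROW `C^ηQ^*_K` ON BAŁABAN'S VOLUMES** («we may extract a decay factor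
exp[−δ₀|x − y|] from (4.45)», p. 675): for `d ≥ 1`, odd `L ≥ 2`, `a > 0`, `m² > 0` there are `δ, c > 0` (functions of
`d, L, a, m²` only) such that for every volume `(d, L, m, K)`, `K ≥ 1`, the unit torus `M_μ = 2L^m`, every spelling
`N = L^K`, EVERY fine point `x` and unit site `b`: `|C^ηQ^*_K(x, b)| ≤ c·exp(−δ·tdistT M (B(x)) b)` (`C^ηQ^*_K = covQstar`,
the conventions of `minimiser`).  Route: `C^ηQ^*_K(x, b) = Σ_{b′} ℋ_K(x, b′)(Δ^{(K)})⁻¹(b′, b)` (`covQstar_kernel_eq_sum`),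
Theorem 3.3 for `ℋ_K` (`minimiser_kernel_decay_blocks`), §1 for `(Δ^{(K)})⁻¹`, and `exp_conv_le`.
[cite: King1986, (4.45) p.675, Prop. 3.7 (3.64) p.663] -/
theorem covQstar_kernel_decay_blocks (dd L : ℕ) (hd : 1 ≤ dd) (hLodd : Odd L) (hL : 2 ≤ L) {a m2 : ℝ}
    (ha : 0 < a) (hm : 0 < m2) :
    ∃ δ c : ℝ, 0 < δ ∧ 0 < c ∧ ∀ (P : Params), P.d = dd → P.L = L → 1 ≤ P.K →
      ∀ (M : Fin P.d → ℕ) [∀ μ, NeZero (M μ)] (_hMK : ∀ μ, M μ = P.sitesPerDir P.K)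
        (N : ℕ) [NeZero N] (_hN : N = P.L ^ P.K) (xt : Tor (fine N M)) (bt : Tor M),
        |covQstar N M (((N : ℕ) : ℝ) ^ 2) m2 (Pi.single bt 1) xt|
          ≤ c * Real.exp (-(δ * tdistT M (blockOf N M xt) bt)) := by
  have hL1 : 1 < L := by omega
  obtain ⟨δ₀, c₀, hδ₀, hc₀, H⟩ := minimiser_kernel_decay_blocks dd L hd ⟨hLodd, hL1⟩ ha hm.le
  -- the rate: half the minimum of the two rates
  set κm := kapM dd a m2 L with hκm
  set γm := gamM a m2 L with hγm
  obtain ⟨hκm0, _⟩ := kapM_pos_le (d := dd) ha hm hL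
  have hγm0 : 0 < γm := gamM_pos ha hm hL
  set δ : ℝ := min δ₀ κm / 2 with hδdef
  have hδ0 : 0 < δ := by rw [hδdef]; exact half_pos (lt_min hδ₀ hκm0)
  have hδ1 : 2 * δ ≤ δ₀ := by rw [hδdef]; linarith [min_le_left δ₀ κm]
  have hδ2 : 2 * δ ≤ κm := by rw [hδdef]; linarith [min_le_right δ₀ κm]
  set Kd := Balaban1983to89.B4Sect5Proof.latticeConst dd with hKd
  have hKdδ : 0 ≤ Kd δ := latticeConst_profile_nonneg dd δ hδ0
  refine ⟨δ, a * c₀ * (2 / γm) * Kd δ + 1, hδ0, by positivity, ?_⟩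
  intro P hPd hPL hK M _ hMK N _ hN xt bt
  subst hN
  haveI : NeZero P.L := ⟨by have := P.hL.2; omega⟩
  have hLr : (1 : ℝ) < P.L := by exact_mod_cast P.hL.2
  have hPL2 : 2 ≤ P.L := by have := P.hL.2; omega
  have hN1 : 1 ≤ P.L ^ P.K := Nat.one_le_pow _ _ (by have := P.hL.2; omega)
  have haK : 0 < aK a P.L P.K := aK_pos ha hLr hK
  -- kernel form
  rw [covQstar_kernel_eq_sum (P.L ^ P.K) M hN1 haK hm bt xt]
  -- termwise: |Δ⁻¹(b',b)|·|ℋ(x,b')|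
  have hterm : ∀ b' : Tor M,
      |(effLaplacian (P.L ^ P.K) M (aK a P.L P.K) (((P.L ^ P.K : ℕ) : ℝ) ^ 2) m2)⁻¹ b' bt
          * minimiser (P.L ^ P.K) M (aK a P.L P.K) (((P.L ^ P.K : ℕ) : ℝ) ^ 2) m2 (Pi.single b' 1) xt|
        ≤ (2 / γm) * Real.exp (-(κm * tdistT M b' bt))
          * (a * c₀ * Real.exp (-(δ₀ * tdistT M (blockOf (P.L ^ P.K) M xt) b'))) := by
    intro b'
    rw [abs_mul]
    have h1 : |(effLaplacian (P.L ^ P.K) M (aK a P.L P.K) (((P.L ^ P.K : ℕ) : ℝ) ^ 2) m2)⁻¹ b' bt|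
        ≤ (2 / γm) * Real.exp (-(κm * tdistT M b' bt)) := by
      have h := effLaplacian_inv_decay (d := P.d) ha hm hPL2 hK M b' bt
      have e1 : gamM a m2 P.L = γm := by rw [hγm, hPL]
      have e2 : kapM P.d a m2 P.L = κm := by rw [hκm, hPL, hPd]
      rw [e1, e2] at h
      exact h
    have h2 : |minimiser (P.L ^ P.K) M (aK a P.L P.K) (((P.L ^ P.K : ℕ) : ℝ) ^ 2) m2 (Pi.single b' 1) xt|
        ≤ a * c₀ * Real.exp (-(δ₀ * tdistT M (blockOf (P.L ^ P.K) M xt) b')) :=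
      (H P hPd hPL hK M hMK (P.L ^ P.K) rfl xt b').trans
        (mul_le_mul_of_nonneg_right (mul_le_mul_of_nonneg_right (aK_le ha hLr hK) hc₀.le) (Real.exp_pos _).le)
    exact mul_le_mul h1 h2 (abs_nonneg _) (by positivity)
  have hpd : IsPseudoDist (tdistT M) := tdistT_isPseudoDist M
  have hconv := exp_conv_le hpd (tdistT_sumBound M) (κ₁ := δ₀) (κ₂ := κm) hδ0 hδ1 hδ2 (blockOf (P.L ^ P.K) M xt) bt
  have hK' : Balaban1983to89.B4Sect5Proof.latticeConst P.d δ = Kd δ := by rw [hKd, hPd]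
  rw [hK'] at hconv
  calc |∑ b' : Tor M, (effLaplacian (P.L ^ P.K) M (aK a P.L P.K) (((P.L ^ P.K : ℕ) : ℝ) ^ 2) m2)⁻¹ b' bt
          * minimiser (P.L ^ P.K) M (aK a P.L P.K) (((P.L ^ P.K : ℕ) : ℝ) ^ 2) m2 (Pi.single b' 1) xt|
      ≤ ∑ b' : Tor M, |(effLaplacian (P.L ^ P.K) M (aK a P.L P.K) (((P.L ^ P.K : ℕ) : ℝ) ^ 2) m2)⁻¹ b' bt
          * minimiser (P.L ^ P.K) M (aK a P.L P.K) (((P.L ^ P.K : ℕ) : ℝ) ^ 2) m2 (Pi.single b' 1) xt| :=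
        Finset.abs_sum_le_sum_abs _ _
    _ ≤ ∑ b' : Tor M, (2 / γm) * Real.exp (-(κm * tdistT M b' bt))
          * (a * c₀ * Real.exp (-(δ₀ * tdistT M (blockOf (P.L ^ P.K) M xt) b'))) :=
        Finset.sum_le_sum fun b' _ => hterm b'
    _ = a * c₀ * (2 / γm) * ∑ b' : Tor M, Real.exp (-(δ₀ * tdistT M (blockOf (P.L ^ P.K) M xt) b'))
          * Real.exp (-(κm * tdistT M b' bt)) := by
        rw [Finset.mul_sum]; refine Finset.sum_congr rfl fun b' _ => ?_; ring
    _ ≤ a * c₀ * (2 / γm) * (Kd δ * Real.exp (-(δ * tdistT M (blockOf (P.L ^ P.K) M xt) bt))) :=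
        mul_le_mul_of_nonneg_left hconv (by positivity)
    _ ≤ (a * c₀ * (2 / γm) * Kd δ + 1) * Real.exp (-(δ * tdistT M (blockOf (P.L ^ P.K) M xt) bt)) := by
        rw [← mul_assoc]
        exact mul_le_mul_of_nonneg_right (by linarith) (Real.exp_pos _).le

end Torus

end Literature.MathematicalPhysics.QuantumFieldTheory.King1986
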